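import Literature.MathematicalPhysics.QuantumFieldTheory.Balaban1983to89.B2Eq265HiggsTower

/-!
# `Balaban1983to89.B2Eq265TailsScale` — [Balaban1982Higgs2] Lemma 2.4 (2.65) p.572, value clause, on the (Higgs)₂,₃ carrier of record:
# the two (2.67) tails in print's `O((Lᵏε)^κ)` form WITH THE PHYSICAL SCALE `Lᵏε` DECOUPLED FROM THE LATTICE PARAMETER `P.mesh k` —
# own F15 `B2Eq265TailsPow.eq265_higgs_region_pow` and own F16 `B2Eq265HiggsTowerPow.eq265_higgs_tower_pow` re-proved with a free scale
# letter `s ∈ (0, 1]` in the radii readings `m ≥ θ₁r(s)`, `R₁ + 1 ≥ θ₂r(s)`, in the threshold size `c₁·tPhi·pℓ ≤ T·s^{−m′}` and in the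
# tails `C′·a_k·s^κ` (F15/F16 are the instances `s := P.mesh k`), as asked by the fold owner (r02, ruling on Q-p23g23-1, seat INBOX
# 2026-08-23): (2.67) p.572, AS PRINTED, «Using Proposition 2.2 and the restrictions (2.55) we get φ^{(k)}(x) = (a_kG_k(□, A^{(k)})Q_k^*(A^{(k)})□₁φ)(x)
# + O((Lᵏε)^κ), x ∈ Bᵏ(y), (2.67)» (`eq265_higgs_region_pow_scale`, `eq265_higgs_tower_pow_scale`)

statement-level skeleton of published theorems with citation tags; proofs where landed; nothing here is a claim
about the Yang–Mills mass gap

PDF held: `paper:balaban1982-cmp86-higgs23-ii` (journal page = PDF page + 554), p. 572 [PDF 18] (Lemma 2.4, (2.65), (2.67)), p. 558 [PDF 4]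
((2.7) «r(ε) = R(1 + log ε⁻¹)^r … r > 1», (2.8)), p. 557 [PDF 3] ((2.2)/(2.5): the couplings `e(ε) = eε^{(4−d)/2}`, `λ(ε) = λε^{4−d}` are
functions of the PHYSICAL lattice spacing), p. 570 [PDF 16] ((2.55)/(2.56); «distant … more than r(Lᵏε)» — the scale entering `r(·)` at step
`k` is the physical `Lᵏε`).

CITATION HEADER (lean-in-tree rule).  T. Bałaban, *(Higgs)₂,₃ quantum fields in a finite volume. II. An upper bound*,
Commun. Math. Phys. **86** (1982) 555–594, doi:10.1007/bf01214890 [Balaban1982Higgs2].  Cell `lit-balaban` (HOME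
`run/shared/lean/pub/lit-balaban/`), Phase-2 proof seat **p23** gen 23 (unit `lit-balaban-p23-g23`; free-target protocol G.5-34(d), TAKING #4
line HOME/STATUS.md 2026-08-23); SKELETON row **B2.Lem2.4** (fold owner r02, second reader r14; head `proved p250408 · …` UNCHANGED —
cells-only member, brick F18a).  USED BY NAME, never restated: own F13 `B2Eq265PrintedForm.eq265_higgs_region_tails`, r14's
`B2StepK.rDecayBeatsPowers_of_printed` ((2.7)/(2.109): `e^{−δ₁r(s)} ≤ C_κ s^κ` on `0 < s ≤ 1` for the printed ranges `B2.Params.Printed`),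
b2b's `B2.rFn` ((2.7) `r(ε) = R(1 + log ε⁻¹)^r`); for the tower form the typer's `B2Eq243RegionsTower.towerRegion`, `B2Eq324NestedRegions.prime`,
`B2Eq28RegionsConcrete.near`, own `B2Eq28RegionsCollars.nbhd_towerRegion` ((2.8) collars), own `B2Eq28RegionsBigBlockUnion.
isBigBlockUnion_towerRegion_prime`, own `B2Eq267HiggsRegion.prime_towerRegion_six_subset_two`, p15's `B2Ineq329BlockPoincare.blockIter_toFinest`.

WHY A FREE SCALE LETTER (the reading question Q-p23g23-1, recorded).  In print the couplings and radii of step `k` are functions of the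
PHYSICAL spacing `Lᵏε` ((2.5), (2.7), (2.55)₄), while the typer's carrier `B2Eq255Concrete` is written on the lattice `HiggsLattice.Params P`
whose `P.mesh k` is read by the typer as the lattice unit of `T^{(k)}` (reading (U)) and by own gen-18/F15/F16 as the physical `Lᵏε`
(reading (P)).  Quantifying the scale `s ∈ (0, 1]` that enters `r(·)`, the threshold size and the `O(·)` SEPARATELY from `P.mesh k` serves
both readings at once: (P) is the instance `s := P.mesh k` (= F15/F16 verbatim), (U) instantiates `s :=` the physical `Lᵏε` of (2.5) with
the lattice letters untouched.  The proof is F15's, with r14's `rDecayBeatsPowers_of_printed` applied at `s` instead of at `P.mesh k`.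

THE ARGUMENT.  F13's first summand is `a_k t′[C₁e^{−m/(4K₀)} + C₂e^{−(R₁+1)/(4K₀)}]`.  With `m ≥ θ₁r(s)`, `R₁ + 1 ≥ θ₂r(s)` the
exponentials are `≤ e^{−θᵢr(s)/(4K₀)} ≤ E_i s^{κ+m′}` (`rDecayBeatsPowers` at the rates `θᵢ/(4K₀)`, `K₀ ≥ 1`), and `t′ ≤ Ts^{−m′}` absorbs the
threshold: the summand is `≤ (C₁E₁⁺ + C₂E₂⁺)T·a_k·s^κ`; the other six terms are untouched (they carry the LATTICE letters `P.mesh k`,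
`P.mesh 0`, `Lᵏ` exactly as in F13).  The tower form is derived from the region form exactly as F16 was from F15 (F14's located edits).

WHAT THIS FILE PROVES (kernel-checked, zero `sorry`; theorems only — NO definition, NO `Prop`-valued fact; axioms standard).
 **`eq265_higgs_region_pow_scale`** — F15's `eq265_higgs_region_pow` word for word except (located edits): the three readings
 `θ₁·r(P.mesh k) ≤ m → θ₂·r(P.mesh k) ≤ R₁ + 1 → c₁·tPhi·pℓ ≤ T(P.mesh k)^{−m′} →` ↦ `∀ {s : ℝ}, 0 < s → s ≤ 1 → θ₁·r(s) ≤ m → θ₂·r(s) ≤ R₁ + 1 →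
 c₁·tPhi·pℓ ≤ T·s^{−m′} →` (same position, after the (2.55) letters); first summand of the bound `C′·a_k·(P.mesh k)^κ` ↦ `C′·a_k·s^κ`.
 **`eq265_higgs_tower_pow_scale`** — F16's `eq265_higgs_tower_pow` with the same two located edits (level `j + 1`); equivalently
 `eq265_higgs_region_pow_scale` with F14's/F16's located edits (tower data `(bad) (rad), 0 < rad j →`, `P.M = M`, room condition
 `∀ (n : ℕ), n < rad j → L(R_n + 1) − 1 ≤ 3n →`); `rad` stays data (print: `rad i = r(Lⁱε)` at the physical scale — under (P) own F16
 `eq265_higgs_tower_pow_r`, under (U) the user's instance).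

HONEST SCOPE / DIFFERENCES FROM PRINT (recorded, not hidden; one sentence each).  (a) = F15 (a): ONLY THE TWO (2.67) TAILS are converted to
`O(s^κ)`; the (2.68)/(2.76)/(2.75)/transport terms stay explicit in the lattice letters — their printed sizes `O((Lᵏε)^{κ₀})`/`O(p(Lᵏε))`
need the (2.5)–(2.7) scaling dictionary (row B2.Lem2.4's «final SIZE» residue, not evaluated here).  (b) The scale `s ∈ (0, 1]` is a free
letter NOT tied to `P` by any hypothesis: print has exactly one scale, `s = Lᵏε`; which typed quantity that is ((U) or (P)) is the cell's
reading question Q-p23g23-1 (fold owner's ruling: (P) for own gen-18/F15/F16; this file serves both).  (c) `θ₁, θ₂ > 0`, `T, m′` free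
(print: `m ⇐ 4r`, `R₁ ⇐ 2r` about `y`); `K₀min` raised to `max K₀min 1`; `C′ = (C₁E₁⁺ + C₂E₂⁺)T` with r14's existential `E_i`.  (d) Tower
form: F14 (a)–(c) verbatim (`□₂ ⊆ Λ₂^{(j)′}`, `□₁ ⊆ Λ₆^{(j)′}`, `Bᵏ(□₂)` a cell box of cube size `M` stay hypotheses; room condition =
the cell's reading (c) of GAPS G-B2-12; `Λ₋₁` the POINT part of `Λ^{(*,′)}_{−1}`; `bad`, `rad` data).  (e) Everything else as in F13's HONEST
SCOPE (value clause only; torus sub-family `Shape P`, odd `L > 1`; zero external field in (2.54); general (2.55) letters; base point the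
corner; nothing minted — all constants are F13's / Lemma 2.3's / r14's).  NOT summit progress.
-/

open scoped BigOperators

noncomputable section

namespace Literature.MathematicalPhysics.QuantumFieldTheory.Balaban1983to89.B2Eq265TailsScale

open HiggsLattice (ChargeData)
open HiggsAveraging (blockIter toFinest)
open HiggsCovariance (avgQkAdj)
open B2Eq255Concrete (bgScalar256 underRegion mem_underRegion Restr255)
open B2Eq265PrintedForm (eq265_higgs_region_tails)
open B2Eq324NestedRegions (prime)
open B2Eq243RegionsTower (towerRegion)
open B2Eq28RegionsConcrete (near)
open B2Eq28RegionsCollars (nbhd_towerRegion)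
open B2Eq28RegionsBigBlockUnion (isBigBlockUnion_towerRegion_prime)
open B2Eq267HiggsRegion (prime_towerRegion_six_subset_two)
open B2Ineq329BlockPoincare (blockIter_toFinest)
open B2Lemma23HiggsLattice (cutMin)
open B1Eq211ZeroFieldTorus (Shape)
open B3MultiscaleFields (toSite ofSite)
open B1Ineq225RegularBox (cellBox)
open B1TorusRegionHSizes (IsBigBlockUnion)
open B1TorusCubeCover (half)
open B1TorusCubeLocality26 (rS)

variable {P : HiggsLattice.Params} {k : ℕ}

/-! ## The (2.67) tails of (2.65) in `O(s^κ)` form, `s` the physical scale — region form -/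

section Scale

/-- **LEMMA 2.4 (2.65), VALUE CLAUSE — the (2.67) tails as print's `O((Lᵏε)^κ)`, the physical scale `s ⇐ Lᵏε` a free letter.**
TYPED vs PRINTED: own F15 `B2Eq265TailsPow.eq265_higgs_region_pow` word for word except the located edits listed in the header (the
three readings `θ₁r(·) ≤ m`, `θ₂r(·) ≤ R₁ + 1`, `c₁·tPhi·pℓ ≤ T(·)^{−m′}` and the tail `C′·a_k·(·)^κ` are taken at a free `s ∈ (0, 1]`
instead of at `P.mesh k`; new binders `∀ {s : ℝ}, 0 < s → s ≤ 1 →` in front of the readings).  F15 is the instance `s := P.mesh k`.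
[cite: Balaban1982Higgs2, Lemma 2.4 (2.65) p.572]
[cite: Balaban1982Higgs2, Lemma 2.4 proof (2.67) p.572 «Using Proposition 2.2 and the restrictions (2.55) we get φ^{(k)}(x) = (a_kG_k(□, A^{(k)})Q_k^*(A^{(k)})□₁φ)(x) + O((Lᵏε)^κ), x ∈ Bᵏ(y)»]
[cite: Balaban1982Higgs2, (2.7) p.558 «r(ε) = R(1 + log ε⁻¹)^r»] [cite: Balaban1982Higgs2, (2.5) p.557 «e(ε) = eε^{(4−d)/2}, λ(ε) = λε^{4−d}»] -/
theorem eq265_higgs_region_pow_scale (d L : ℕ) (hd : 1 ≤ d) (hL : Odd L ∧ 1 < L) {a : ℝ} (ha : 0 < a) {msq : ℝ} (hmsq : 0 < msq)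
    {aV : ℝ} (haV : 0 < aV) {mu0sq : ℝ} (hmu0 : 0 < mu0sq)
    (N : ℕ) (C : ChargeData N) (ε₀ : ℝ) (creg β : ℝ) (hcreg : 0 ≤ creg) (hβ : 0 < β)
    (Q : B2.Params) (hQ : Q.Printed) {T : ℝ} (hT : 0 ≤ T) (mexp : ℝ) {θ₁ θ₂ : ℝ} (hθ₁ : 0 < θ₁) (hθ₂ : 0 < θ₂) (κ : ℝ) :
    ∃ δ CV CF : ℝ, 0 < δ ∧ 0 < CV ∧ 0 < CF ∧
    ∃ K₀min : ℕ, ∀ K₀ : ℕ, K₀min ≤ K₀ → ∃ e₁ t : ℝ, 0 < e₁ ∧ 0 < t ∧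
      ∃ C₁ C₂ C₃ D₁ D₂ D₃ D₄ : ℝ, 0 ≤ C₁ ∧ 0 ≤ C₂ ∧ 0 ≤ C₃ ∧ 0 ≤ D₁ ∧ 0 ≤ D₂ ∧ 0 ≤ D₃ ∧ 0 ≤ D₄ ∧ ∃ C' : ℝ, 0 ≤ C' ∧
      ∀ (P : HiggsLattice.Params) (_ : Shape P), P.d = d → P.L = L → K₀ ∣ P.M →
      ∀ {k : ℕ}, 1 ≤ k → k ≤ P.K → (∀ μ, 3 * half P k K₀ ≤ P.sitesPerDir 0 μ) → P.mesh k ≤ ε₀ → P.mesh k ≤ 1 →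
      ∀ (Λ₂ Λ₆ sq₂ sq₁ : Finset (HiggsLattice.Site P k)) (S : Fin P.d → Finset ℕ) (q : HiggsLattice.Site P k) (Sbox : ℕ),
        Λ₆ ⊆ Λ₂ → sq₂ ⊆ Λ₂ → sq₁ ⊆ Λ₆ →
        IsBigBlockUnion k K₀ (underRegion k Λ₂) → underRegion k sq₂ = cellBox k K₀ S →
        (∀ μ : Fin P.d, P.L ^ k * Sbox < P.sitesPerDir 0 μ) →
      -- `□₂` IS the box `q + [0,S)ᵈ` of coarse sites, `□ = B^k(□₂)` smaller than half the torus
        (∀ y : HiggsLattice.Site P k, y ∈ sq₂ ↔ ∀ ν : Fin P.d, (y ν - q ν).val < Sbox) →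
        (∀ μ : Fin P.d, 2 * (P.L ^ k * Sbox) ≤ P.sitesPerDir 0 μ) →
      -- `□₁` is the box of coarse sites of radius `R₁` (corner `q₁`); `m ≥ R₁` a coarse margin with `Lᵏm ≥` the depth radius
      ∀ (q₁ : HiggsLattice.Site P k) (R₁ m : ℕ), R₁ ≤ m → 2 * rS P k K₀ + 2 * half P k K₀ * (P.d + 1) + 1 ≤ P.L ^ k * m →
        (∀ y : HiggsLattice.Site P k, y ∈ sq₁ ↔ ∀ ν : Fin P.d, (y ν - q₁ ν).val < 2 * R₁ + 1) →
      -- the region `Λ₋₁` of (2.55); the cutoff `ζ^{(k)}` of (2.44); the cube of radius `R_n ≥ ρ + 1` about every `y ∈ Λ₂` inside `Λ₋₁` ((2.8))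
      ∀ (Λm1 : Finset (HiggsLattice.Site P k))
        (ζ : HiggsLattice.Site P 0 → HiggsLattice.Site P k → ℝ) (ρ ρ₁ : ℝ), 0 ≤ ρ₁ →
        (∀ x y', |ζ x y'| ≤ 1) →
        (∀ x y', ζ x y' ≠ 0 → (HiggsLattice.Site.tdist (blockIter k x) y' : ℝ) ≤ ρ) →
        (∀ x y', (HiggsLattice.Site.tdist (blockIter k x) y' : ℝ) ≤ ρ₁ → ζ x y' = 1) →
        (∀ (x : HiggsLattice.Site P 0) (ν : Fin P.d) (y' : HiggsLattice.Site P k), |ζ (x.shift ν) y' - ζ x y'| ≤ ((P.L : ℝ) ^ k)⁻¹) →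
      ∀ (Rn : ℕ), ρ + 1 ≤ (Rn : ℝ) → (∀ μ : Fin P.d, 2 * (2 * Rn + 1) ≤ P.sitesPerDir k μ) →
        (∀ y ∈ Λ₂, ∀ y' : HiggsLattice.Site P k, HiggsLattice.Site.tdist y y' ≤ Rn → y' ∈ Λm1) →
      -- a charge datum on `ℝ^d`, the step's vector field `A′`, and the letters of (2.55)
      ∀ (C₀ : ChargeData P.d) (A' : HiggsLattice.VecField P k) {c₁ pℓ tA tPhi : ℝ}, 0 ≤ c₁ → 0 ≤ pℓ → 0 ≤ tPhi →
      -- THE PHYSICAL SCALE `s ⇐ Lᵏε` AS A FREE LETTER: radii readings `m ≥ θ₁r(s)`, `R₁ + 1 ≥ θ₂r(s)` and threshold size `c₁·tPhi·pℓ ≤ T·s^{−m′}`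
      ∀ {s : ℝ}, 0 < s → s ≤ 1 →
        θ₁ * B2.rFn Q.R Q.r s ≤ (m : ℝ) → θ₂ * B2.rFn Q.R Q.r s ≤ (R₁ : ℝ) + 1 →
        c₁ * tPhi * pℓ ≤ T * s ^ (-mexp) →
      -- `δA` is at least the (2.60) bound read off (2.55)₁,₂, and small in the two printed scalings
      ∀ {δA : ℝ}, ((P.L : ℝ) ^ k)⁻¹ * (CV * P.d * (P.mesh k * (c₁ * pℓ)) + CF * Real.exp (-(δ * ρ₁)) * (c₁ * tA * pℓ)) ≤ δA →
          (P.L : ℝ) ^ k * δA * |C.e| ≤ t →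
        ∀ {ec : ℝ}, 0 < ec → ec ≤ e₁ → (P.L : ℝ) ^ k * P.mesh k * |C.e| * δA ≤ creg * ec ^ β →
      -- `x ∈ Bᵏ(ȳ)` with `ȳ` the centre of `□₁` and at least `m` inside `□₂` in every direction
      ∀ (x : HiggsLattice.Site P 0),
        (∀ ν : Fin P.d, m ≤ ((blockIter k x) ν - q ν).val ∧ ((blockIter k x) ν - q ν).val + m < Sbox) →
        (∀ ν : Fin P.d, ((blockIter k x) ν - q₁ ν).val = R₁) →
      -- THE RESTRICTIONS (2.55) on `Λ₋₁` for the fields `A′, φ` of the step and the background `A^{(k)} = a_kζ^{(k)}G_kQ_k^*A′` — all four conjuncts used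
      ∀ (φ : HiggsLattice.ScalarField P k N),
        Restr255 C c₁ pℓ tA tPhi k Λm1 A' φ (ofSite (cutMin C₀ mu0sq aV k ζ (toSite A'))) →
        ‖bgScalar256 C msq a k Λ₂ Λ₆ (ofSite (cutMin C₀ mu0sq aV k ζ (toSite A'))) φ x
            - avgQkAdj C (ofSite (cutMin C₀ mu0sq aV k ζ (toSite A'))) k φ x‖
          ≤ C' * B1.aSeq a P.L k * s ^ κ
            + (D₁ * P.mesh k ^ 2 *
                (B1.aSeq a P.L k * (P.mesh k)⁻¹ ^ 2 * (|C.e| * (δA * (P.d * ((P.L : ℝ) ^ k * Sbox))) * P.mesh 0 * (P.d * ((P.L : ℝ) ^ k - 1))) * (c₁ * tPhi * pℓ)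
                  + |C.e| * (δA * (P.d * ((P.L : ℝ) ^ k * Sbox))) * (P.d * ((B1.aSeq a P.L k * (P.mesh k)⁻¹ ^ 2 * (c₁ * tPhi * pℓ) * D₄ * P.mesh k
                        + |C.e| * (δA * (P.d * ((P.L : ℝ) ^ k * Sbox))) * (B1.aSeq a P.L k * D₃ * (c₁ * tPhi * pℓ))) + |C.e| * (δA * (P.d * ((P.L : ℝ) ^ k * Sbox))) * (B1.aSeq a P.L k * D₃ * (c₁ * tPhi * pℓ))))
                  + B1.aSeq a P.L k * (P.mesh k)⁻¹ ^ 2 *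
                      ((2 * (|C.e| * (δA * (P.d * ((P.L : ℝ) ^ k * Sbox))) * P.mesh 0 * (P.d * ((P.L : ℝ) ^ k - 1)))
                        + (|C.e| * (δA * (P.d * ((P.L : ℝ) ^ k * Sbox))) * P.mesh 0 * (P.d * ((P.L : ℝ) ^ k - 1))) ^ 2) * (B1.aSeq a P.L k * D₃ * (c₁ * tPhi * pℓ))))
              + D₂ * P.mesh k * (|C.e| * (δA * (P.d * ((P.L : ℝ) ^ k * Sbox))) * (B1.aSeq a P.L k * D₃ * (c₁ * tPhi * pℓ))))
            + B1.aSeq a P.L k * C₃ *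
                (4 * K₀ * ((P.mesh k * (c₁ * pℓ) + P.mesh k * |C.e| * (δA * (P.d * ((P.L : ℝ) ^ k * Sbox))) * (c₁ * tPhi * pℓ)) * P.d)
                  + Real.exp (-(1 / (4 * K₀) * ((R₁ : ℝ) + 1))) * (c₁ * tPhi * pℓ))
            + msq * P.mesh k ^ 2 / (B1.aSeq a P.L k + msq * P.mesh k ^ 2) * (c₁ * tPhi * pℓ)
            + |C.e| * P.mesh 0 * (P.d * ((P.L : ℝ) ^ k - 1)) * (δA * (P.d * ((P.L : ℝ) ^ k * Sbox))) * (c₁ * tPhi * pℓ) := by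
  obtain ⟨δ, CV, CF, hδ, hCV, hCF, K₀min, h⟩ := eq265_higgs_region_tails d L hd hL ha hmsq haV hmu0 N C ε₀ creg β hcreg hβ
  refine ⟨δ, CV, CF, hδ, hCV, hCF, max K₀min 1, fun K₀ hK₀ => ?_⟩
  obtain ⟨e₁, t, he₁, ht, C₁, C₂, C₃, D₁, D₂, D₃, D₄, hC₁, hC₂, hC₃, hD₁, hD₂, hD₃, hD₄, h⟩ := h K₀ ((le_max_left _ _).trans hK₀)
  have hK₀1 : (1 : ℝ) ≤ K₀ := by exact_mod_cast (le_max_right _ _).trans hK₀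
  have hδ₀ : (0 : ℝ) < 1 / (4 * K₀) := by positivity
  have hr₁ : (0 : ℝ) < θ₁ * (1 / (4 * K₀)) := by positivity
  have hr₂ : (0 : ℝ) < θ₂ * (1 / (4 * K₀)) := by positivity
  obtain ⟨E₁, hE₁⟩ := B2StepK.rDecayBeatsPowers_of_printed Q hQ hr₁ (κ + mexp)
  obtain ⟨E₂, hE₂⟩ := B2StepK.rDecayBeatsPowers_of_printed Q hQ hr₂ (κ + mexp)
  -- `E₁, E₂ ≥ 0` may fail for the abstract constants; use their positive parts
  refine ⟨e₁, t, he₁, ht, C₁, C₂, C₃, D₁, D₂, D₃, D₄, hC₁, hC₂, hC₃, hD₁, hD₂, hD₃, hD₄,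
    (C₁ * max E₁ 0 + C₂ * max E₂ 0) * T, by positivity, ?_⟩
  intro P S hPd hPL hK₀M k hk1 hkK h3 hε h1 Λ₂ Λ₆ sq₂ sq₁ Sfin q Sbox h62 hs2 h16 hΩΛ hbox hSbox hsq₂ h2S q₁ R₁ m hR₁m hRm hsq₁
    Λm1 ζ ρ ρ₁ hρ₁ zeta_abs zeta_supp zeta_one zeta_lip Rn hRn hRn2 hcube C₀ A' c₁ pℓ tA tPhi hc₁ hpℓ htPhi s hs hs1 hθm hθR htT δA
    h60δ ht' ec hec hle hsmall x hmargin hcentre φ h255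
  have hmain := h P S hPd hPL hK₀M hk1 hkK h3 hε h1 Λ₂ Λ₆ sq₂ sq₁ Sfin q Sbox h62 hs2 h16 hΩΛ hbox hSbox hsq₂ h2S q₁ R₁ m hR₁m hRm hsq₁
    Λm1 ζ ρ ρ₁ hρ₁ zeta_abs zeta_supp zeta_one zeta_lip Rn hRn hRn2 hcube C₀ A' hc₁ hpℓ htPhi h60δ ht' hec hle hsmall x hmargin hcentre φ
    h255
  -- the two tails beat every power of the scale `s`
  set r := B2.rFn Q.R Q.r s with hrdef
  have hLr : 1 < (P.L : ℝ) := by rw [hPL]; exact_mod_cast hL.2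
  have hak : 0 ≤ B1.aSeq a P.L k := (B1.aSeq_pos ha hLr hk1).le
  have ht0 : 0 ≤ c₁ * tPhi * pℓ := mul_nonneg (mul_nonneg hc₁ htPhi) hpℓ
  have hm' : θ₁ * (1 / (4 * K₀)) * r ≤ 1 / (4 * K₀) * (m : ℝ) := by
    have h' := mul_le_mul_of_nonneg_left hθm hδ₀.le
    calc θ₁ * (1 / (4 * K₀)) * r = 1 / (4 * K₀) * (θ₁ * r) := by ring
      _ ≤ 1 / (4 * K₀) * (m : ℝ) := h'
  have hR' : θ₂ * (1 / (4 * K₀)) * r ≤ 1 / (4 * K₀) * ((R₁ : ℝ) + 1) := by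
    have h' := mul_le_mul_of_nonneg_left hθR hδ₀.le
    calc θ₂ * (1 / (4 * K₀)) * r = 1 / (4 * K₀) * (θ₂ * r) := by ring
      _ ≤ 1 / (4 * K₀) * ((R₁ : ℝ) + 1) := h'
  have hex₁ : Real.exp (-(1 / (4 * K₀) * (m : ℝ))) ≤ max E₁ 0 * s ^ (κ + mexp) := by
    calc Real.exp (-(1 / (4 * K₀) * (m : ℝ))) ≤ Real.exp (-(θ₁ * (1 / (4 * K₀)) * r)) :=
          Real.exp_le_exp.mpr (neg_le_neg hm')
      _ ≤ E₁ * s ^ (κ + mexp) := hE₁ s hs hs1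
      _ ≤ max E₁ 0 * s ^ (κ + mexp) := mul_le_mul_of_nonneg_right (le_max_left _ _) (Real.rpow_nonneg hs.le _)
  have hex₂ : Real.exp (-(1 / (4 * K₀) * ((R₁ : ℝ) + 1))) ≤ max E₂ 0 * s ^ (κ + mexp) := by
    calc Real.exp (-(1 / (4 * K₀) * ((R₁ : ℝ) + 1))) ≤ Real.exp (-(θ₂ * (1 / (4 * K₀)) * r)) :=
          Real.exp_le_exp.mpr (neg_le_neg hR')
      _ ≤ E₂ * s ^ (κ + mexp) := hE₂ s hs hs1
      _ ≤ max E₂ 0 * s ^ (κ + mexp) := mul_le_mul_of_nonneg_right (le_max_left _ _) (Real.rpow_nonneg hs.le _)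
  have hpow : s ^ (-mexp) * s ^ (κ + mexp) = s ^ κ := by
    rw [← Real.rpow_add hs]; ring_nf
  have hsum0 : 0 ≤ C₁ * Real.exp (-(1 / (4 * K₀) * (m : ℝ))) + C₂ * Real.exp (-(1 / (4 * K₀) * ((R₁ : ℝ) + 1))) :=
    add_nonneg (mul_nonneg hC₁ (Real.exp_nonneg _)) (mul_nonneg hC₂ (Real.exp_nonneg _))
  have hTm : 0 ≤ T * s ^ (-mexp) := mul_nonneg hT (Real.rpow_nonneg hs.le _)
  have hfirst : B1.aSeq a P.L k * (c₁ * tPhi * pℓ) *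
        (C₁ * Real.exp (-(1 / (4 * K₀) * (m : ℝ))) + C₂ * Real.exp (-(1 / (4 * K₀) * ((R₁ : ℝ) + 1))))
      ≤ (C₁ * max E₁ 0 + C₂ * max E₂ 0) * T * B1.aSeq a P.L k * s ^ κ := by
    calc B1.aSeq a P.L k * (c₁ * tPhi * pℓ) *
          (C₁ * Real.exp (-(1 / (4 * K₀) * (m : ℝ))) + C₂ * Real.exp (-(1 / (4 * K₀) * ((R₁ : ℝ) + 1))))
        ≤ B1.aSeq a P.L k * (T * s ^ (-mexp)) *
          (C₁ * Real.exp (-(1 / (4 * K₀) * (m : ℝ))) + C₂ * Real.exp (-(1 / (4 * K₀) * ((R₁ : ℝ) + 1)))) :=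
          mul_le_mul_of_nonneg_right (mul_le_mul_of_nonneg_left htT hak) hsum0
      _ ≤ B1.aSeq a P.L k * (T * s ^ (-mexp)) * (C₁ * (max E₁ 0 * s ^ (κ + mexp)) + C₂ * (max E₂ 0 * s ^ (κ + mexp))) :=
          mul_le_mul_of_nonneg_left (add_le_add (mul_le_mul_of_nonneg_left hex₁ hC₁) (mul_le_mul_of_nonneg_left hex₂ hC₂))
            (mul_nonneg hak hTm)
      _ = (C₁ * max E₁ 0 + C₂ * max E₂ 0) * T * B1.aSeq a P.L k * (s ^ (-mexp) * s ^ (κ + mexp)) := by ring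
      _ = (C₁ * max E₁ 0 + C₂ * max E₂ 0) * T * B1.aSeq a P.L k * s ^ κ := by rw [hpow]
  exact hmain.trans (add_le_add (add_le_add (add_le_add (add_le_add hfirst le_rfl) le_rfl) le_rfl) le_rfl)

/-! ## The same for print's own tower regions (F14's/F16's located edits) -/

/-- **LEMMA 2.4 (2.65), VALUE CLAUSE, FOR PRINT'S OWN REGIONS `Λ₂^{(k−1)′} ⊇ Λ₆^{(k−1)′}`, `Λ₋₁^{(k−1)′} ⊇ (near Λ₀^{(k−1)} r)′`, cube
size `K₀ = M`, THE TWO (2.67) TAILS AS `O(s^κ)` AT A FREE PHYSICAL SCALE `s ⇐ Lᵏε`.**  TYPED vs PRINTED: own F16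
`B2Eq265HiggsTowerPow.eq265_higgs_tower_pow` word for word except the two located edits of `eq265_higgs_region_pow_scale` (readings and
tail at `s`, binders `∀ {s : ℝ}, 0 < s → s ≤ 1 →`); equivalently `eq265_higgs_region_pow_scale` with F14's located edits (`∃ Mmin ∀ M ≥ Mmin …
P.M = M`; level `j + 1`; tower data `(bad) (rad), 0 < rad j →` with `Λ₂ := prime (towerRegion bad rad j 2)`, `Λ₆ := prime (towerRegion bad rad j 6)`,
`Λm1 := prime (near (towerRegion bad rad j 0) (rad j))`; cube condition ↦ `∀ (n : ℕ), n < rad j → L(R_n + 1) − 1 ≤ 3n →`).  F16 is the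
instance `s := P.mesh (j + 1)`; `rad` stays data.  Nothing is minted: `Mmin` IS `max K₀min 1` with F13's `K₀min`, all constants F13's / r14's.
[cite: Balaban1982Higgs2, Lemma 2.4 (2.65) p.572] [cite: Balaban1982Higgs2, (2.56) p.570, (2.55) p.570, (2.7)–(2.8) p.558, (2.43) p.566]
[cite: Balaban1982Higgs2, Lemma 2.4 proof (2.67) p.572 «… + O((Lᵏε)^κ), x ∈ Bᵏ(y)»]
[cite: Balaban1982Higgs1, Prop. 2.1 p.610 «let Ω^{(k)} ⊂ T^{(k)}_1 be a sum of big blocks with M sufficiently large»] -/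
theorem eq265_higgs_tower_pow_scale (d L : ℕ) (hd : 1 ≤ d) (hL : Odd L ∧ 1 < L) {a : ℝ} (ha : 0 < a) {msq : ℝ} (hmsq : 0 < msq)
    {aV : ℝ} (haV : 0 < aV) {mu0sq : ℝ} (hmu0 : 0 < mu0sq)
    (N : ℕ) (C : ChargeData N) (ε₀ : ℝ) (creg β : ℝ) (hcreg : 0 ≤ creg) (hβ : 0 < β)
    (Q : B2.Params) (hQ : Q.Printed) {T : ℝ} (hT : 0 ≤ T) (mexp : ℝ) {θ₁ θ₂ : ℝ} (hθ₁ : 0 < θ₁) (hθ₂ : 0 < θ₂) (κ : ℝ) :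
    ∃ δ CV CF : ℝ, 0 < δ ∧ 0 < CV ∧ 0 < CF ∧
    ∃ Mmin : ℕ, ∀ M : ℕ, Mmin ≤ M → ∃ e₁ t : ℝ, 0 < e₁ ∧ 0 < t ∧
      ∃ C₁ C₂ C₃ D₁ D₂ D₃ D₄ : ℝ, 0 ≤ C₁ ∧ 0 ≤ C₂ ∧ 0 ≤ C₃ ∧ 0 ≤ D₁ ∧ 0 ≤ D₂ ∧ 0 ≤ D₃ ∧ 0 ≤ D₄ ∧ ∃ C' : ℝ, 0 ≤ C' ∧
      ∀ (P : HiggsLattice.Params) (_ : Shape P), P.d = d → P.L = L → P.M = M →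
      ∀ {j : ℕ}, j + 1 ≤ P.K → (∀ μ, 3 * half P (j + 1) M ≤ P.sitesPerDir 0 μ) → P.mesh (j + 1) ≤ ε₀ → P.mesh (j + 1) ≤ 1 →
      -- PRINT'S OWN REGIONS: the (2.7)–(2.8)/(2.43) tower of step `j`, primed to `T^{(k)}`, `k = j + 1`; `Λ₂′ ⊇ □₂`, `Λ₆′ ⊇ □₁`
      ∀ (bad : (l : ℕ) → Set (HiggsLattice.Site P l)) (rad : ℕ → ℝ), 0 < rad j →
      ∀ (sq₂ sq₁ : Finset (HiggsLattice.Site P (j + 1))) (S : Fin P.d → Finset ℕ) (q : HiggsLattice.Site P (j + 1)) (Sbox : ℕ),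
        sq₂ ⊆ prime (towerRegion bad rad j 2) → sq₁ ⊆ prime (towerRegion bad rad j 6) →
        underRegion (j + 1) sq₂ = cellBox (j + 1) M S →
        (∀ μ : Fin P.d, P.L ^ (j + 1) * Sbox < P.sitesPerDir 0 μ) →
      -- `□₂` IS the box `q + [0,S)ᵈ` of coarse sites, `□ = B^k(□₂)` smaller than half the torus
        (∀ y : HiggsLattice.Site P (j + 1), y ∈ sq₂ ↔ ∀ ν : Fin P.d, (y ν - q ν).val < Sbox) →
        (∀ μ : Fin P.d, 2 * (P.L ^ (j + 1) * Sbox) ≤ P.sitesPerDir 0 μ) →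
      -- `□₁` is the box of coarse sites of radius `R₁` (corner `q₁`); `m ≥ R₁` a coarse margin with `Lᵏm ≥` the depth radius
      ∀ (q₁ : HiggsLattice.Site P (j + 1)) (R₁ m : ℕ), R₁ ≤ m → 2 * rS P (j + 1) M + 2 * half P (j + 1) M * (P.d + 1) + 1 ≤ P.L ^ (j + 1) * m →
        (∀ y : HiggsLattice.Site P (j + 1), y ∈ sq₁ ↔ ∀ ν : Fin P.d, (y ν - q₁ ν).val < 2 * R₁ + 1) →
      -- the cutoff `ζ^{(k)}` of (2.44)
      ∀ (ζ : HiggsLattice.Site P 0 → HiggsLattice.Site P (j + 1) → ℝ) (ρ ρ₁ : ℝ), 0 ≤ ρ₁ →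
        (∀ x y', |ζ x y'| ≤ 1) →
        (∀ x y', ζ x y' ≠ 0 → (HiggsLattice.Site.tdist (blockIter (j + 1) x) y' : ℝ) ≤ ρ) →
        (∀ x y', (HiggsLattice.Site.tdist (blockIter (j + 1) x) y' : ℝ) ≤ ρ₁ → ζ x y' = 1) →
        (∀ (x : HiggsLattice.Site P 0) (ν : Fin P.d) (y' : HiggsLattice.Site P (j + 1)), |ζ (x.shift ν) y' - ζ x y'| ≤ ((P.L : ℝ) ^ (j + 1))⁻¹) →
      -- the cube of radius `R_n ≥ ρ + 1` about `y ∈ Λ₂′` lies in `Λ₋₁′ := (near Λ₀^{(j)} r(Lʲε))′` once `L(R_n + 1) − 1 ≤ 3n`, `n < r(Lʲε)` ((2.8) collars)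
      ∀ (Rn : ℕ), ρ + 1 ≤ (Rn : ℝ) → (∀ μ : Fin P.d, 2 * (2 * Rn + 1) ≤ P.sitesPerDir (j + 1) μ) →
      ∀ (n : ℕ), (n : ℝ) < rad j → (P.L : ℝ) * ((Rn : ℝ) + 1) - 1 ≤ 3 * (n : ℝ) →
      -- a charge datum on `ℝ^d`, the step's vector field `A′`, and the letters of (2.55)
      ∀ (C₀ : ChargeData P.d) (A' : HiggsLattice.VecField P (j + 1)) {c₁ pℓ tA tPhi : ℝ}, 0 ≤ c₁ → 0 ≤ pℓ → 0 ≤ tPhi →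
      -- THE PHYSICAL SCALE `s ⇐ Lᵏε` AS A FREE LETTER: radii readings and threshold size at `s`
      ∀ {s : ℝ}, 0 < s → s ≤ 1 →
        θ₁ * B2.rFn Q.R Q.r s ≤ (m : ℝ) → θ₂ * B2.rFn Q.R Q.r s ≤ (R₁ : ℝ) + 1 →
        c₁ * tPhi * pℓ ≤ T * s ^ (-mexp) →
      -- `δA` is at least the (2.60) bound read off (2.55)₁,₂, and small in the two printed scalings
      ∀ {δA : ℝ}, ((P.L : ℝ) ^ (j + 1))⁻¹ * (CV * P.d * (P.mesh (j + 1) * (c₁ * pℓ)) + CF * Real.exp (-(δ * ρ₁)) * (c₁ * tA * pℓ)) ≤ δA →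
          (P.L : ℝ) ^ (j + 1) * δA * |C.e| ≤ t →
        ∀ {ec : ℝ}, 0 < ec → ec ≤ e₁ → (P.L : ℝ) ^ (j + 1) * P.mesh (j + 1) * |C.e| * δA ≤ creg * ec ^ β →
      -- `x ∈ Bᵏ(ȳ)` with `ȳ` the centre of `□₁` and at least `m` inside `□₂` in every direction
      ∀ (x : HiggsLattice.Site P 0),
        (∀ ν : Fin P.d, m ≤ ((blockIter (j + 1) x) ν - q ν).val ∧ ((blockIter (j + 1) x) ν - q ν).val + m < Sbox) →
        (∀ ν : Fin P.d, ((blockIter (j + 1) x) ν - q₁ ν).val = R₁) →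
      -- THE RESTRICTIONS (2.55) on `Λ₋₁` for the fields `A′, φ` of the step and the background `A^{(k)} = a_kζ^{(k)}G_kQ_k^*A′` — all four conjuncts used
      ∀ (φ : HiggsLattice.ScalarField P (j + 1) N),
        Restr255 C c₁ pℓ tA tPhi (j + 1) (prime (near (towerRegion bad rad j 0) (rad j))) A' φ
          (ofSite (cutMin C₀ mu0sq aV (j + 1) ζ (toSite A'))) →
        ‖bgScalar256 C msq a (j + 1) (prime (towerRegion bad rad j 2)) (prime (towerRegion bad rad j 6))
              (ofSite (cutMin C₀ mu0sq aV (j + 1) ζ (toSite A'))) φ x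
            - avgQkAdj C (ofSite (cutMin C₀ mu0sq aV (j + 1) ζ (toSite A'))) (j + 1) φ x‖
          ≤ C' * B1.aSeq a P.L (j + 1) * s ^ κ
            + (D₁ * P.mesh (j + 1) ^ 2 *
                (B1.aSeq a P.L (j + 1) * (P.mesh (j + 1))⁻¹ ^ 2 * (|C.e| * (δA * (P.d * ((P.L : ℝ) ^ (j + 1) * Sbox))) * P.mesh 0 * (P.d * ((P.L : ℝ) ^ (j + 1) - 1))) * (c₁ * tPhi * pℓ)
                  + |C.e| * (δA * (P.d * ((P.L : ℝ) ^ (j + 1) * Sbox))) * (P.d * ((B1.aSeq a P.L (j + 1) * (P.mesh (j + 1))⁻¹ ^ 2 * (c₁ * tPhi * pℓ) * D₄ * P.mesh (j + 1)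
                        + |C.e| * (δA * (P.d * ((P.L : ℝ) ^ (j + 1) * Sbox))) * (B1.aSeq a P.L (j + 1) * D₃ * (c₁ * tPhi * pℓ))) + |C.e| * (δA * (P.d * ((P.L : ℝ) ^ (j + 1) * Sbox))) * (B1.aSeq a P.L (j + 1) * D₃ * (c₁ * tPhi * pℓ))))
                  + B1.aSeq a P.L (j + 1) * (P.mesh (j + 1))⁻¹ ^ 2 *
                      ((2 * (|C.e| * (δA * (P.d * ((P.L : ℝ) ^ (j + 1) * Sbox))) * P.mesh 0 * (P.d * ((P.L : ℝ) ^ (j + 1) - 1)))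
                        + (|C.e| * (δA * (P.d * ((P.L : ℝ) ^ (j + 1) * Sbox))) * P.mesh 0 * (P.d * ((P.L : ℝ) ^ (j + 1) - 1))) ^ 2) * (B1.aSeq a P.L (j + 1) * D₃ * (c₁ * tPhi * pℓ))))
              + D₂ * P.mesh (j + 1) * (|C.e| * (δA * (P.d * ((P.L : ℝ) ^ (j + 1) * Sbox))) * (B1.aSeq a P.L (j + 1) * D₃ * (c₁ * tPhi * pℓ))))
            + B1.aSeq a P.L (j + 1) * C₃ *
                (4 * M * ((P.mesh (j + 1) * (c₁ * pℓ) + P.mesh (j + 1) * |C.e| * (δA * (P.d * ((P.L : ℝ) ^ (j + 1) * Sbox))) * (c₁ * tPhi * pℓ)) * P.d)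
                  + Real.exp (-(1 / (4 * M) * ((R₁ : ℝ) + 1))) * (c₁ * tPhi * pℓ))
            + msq * P.mesh (j + 1) ^ 2 / (B1.aSeq a P.L (j + 1) + msq * P.mesh (j + 1) ^ 2) * (c₁ * tPhi * pℓ)
            + |C.e| * P.mesh 0 * (P.d * ((P.L : ℝ) ^ (j + 1) - 1)) * (δA * (P.d * ((P.L : ℝ) ^ (j + 1) * Sbox))) * (c₁ * tPhi * pℓ) := by
  obtain ⟨δ, CV, CF, hδ, hCV, hCF, K₀min, h⟩ :=
    eq265_higgs_region_pow_scale d L hd hL ha hmsq haV hmu0 N C ε₀ creg β hcreg hβ Q hQ hT mexp hθ₁ hθ₂ κ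
  refine ⟨δ, CV, CF, hδ, hCV, hCF, K₀min, fun M hM => ?_⟩
  obtain ⟨e₁, t, he₁, ht, C₁, C₂, C₃, D₁, D₂, D₃, D₄, hC₁, hC₂, hC₃, hD₁, hD₂, hD₃, hD₄, C', hC', h⟩ := h M hM
  refine ⟨e₁, t, he₁, ht, C₁, C₂, C₃, D₁, D₂, D₃, D₄, hC₁, hC₂, hC₃, hD₁, hD₂, hD₃, hD₄, C', hC', ?_⟩
  intro P S hPd hPL hPM j hjK h3 hε h1 bad rad hrad sq₂ sq₁ Sfin q Sbox hs2 h16 hbox hSbox hsq₂ h2S q₁ R₁ m hR₁m hRm hsq₁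
    ζ ρ ρ₁ hρ₁ zeta_abs zeta_supp zeta_one zeta_lip Rn hRn hRn2 n hn hroom C₀ A' c₁ pℓ tA tPhi hc₁ hpℓ htPhi s hs hs1 hθm hθR htT
    δA h60δ ht' ec hec hle hsmall x hmargin hcentre φ h255
  -- the tower supplies: `M ∣ M`, `Λ₆′ ⊆ Λ₂′`, `Bᵏ(Λ₂′)` a big-block union of cube size `M`, and the cube condition into `Λ₋₁′`
  have hdvd : M ∣ P.M := hPM ▸ dvd_refl _
  have h62 : prime (towerRegion bad rad j 6) ⊆ prime (towerRegion bad rad j 2) := prime_towerRegion_six_subset_two bad hrad.le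
  have hΩ : IsBigBlockUnion (j + 1) M (underRegion (j + 1) (prime (towerRegion bad rad j 2))) :=
    hPM ▸ isBigBlockUnion_towerRegion_prime bad rad j 2
  have hjK' : j < P.K := hjK
  have hcube : ∀ y ∈ prime (towerRegion bad rad j 2), ∀ y' : HiggsLattice.Site P (j + 1),
      HiggsLattice.Site.tdist y y' ≤ Rn → y' ∈ prime (near (towerRegion bad rad j 0) (rad j)) := by
    intro y hy y' hyy'
    have hx : blockIter (j + 1) (toFinest y) ∈ prime (towerRegion bad rad j 2) := by rwa [blockIter_toFinest hjK]
    have hd' : (HiggsLattice.Site.tdist (blockIter (j + 1) (toFinest y)) y' : ℝ) ≤ ((Rn : ℝ) - 1) + 1 := by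
      rw [blockIter_toFinest hjK]; linarith [show (HiggsLattice.Site.tdist y y' : ℝ) ≤ Rn by exact_mod_cast hyy']
    have hroom' : (P.L : ℝ) * (((Rn : ℝ) - 1) + 2) - 1 ≤ 3 * (n : ℝ) := by linarith
    exact nbhd_towerRegion hjK' hrad.le hn hroom' (toFinest y) y' hx hd'
  exact h P S hPd hPL hdvd (Nat.succ_le_succ (Nat.zero_le j)) hjK h3 hε h1 _ _ sq₂ sq₁ Sfin q Sbox h62 hs2 h16 hΩ hbox hSbox hsq₂
    h2S q₁ R₁ m hR₁m hRm hsq₁ _ ζ ρ ρ₁ hρ₁ zeta_abs zeta_supp zeta_one zeta_lip Rn hRn hRn2 hcube C₀ A' hc₁ hpℓ htPhi hs hs1 hθm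
    hθR htT h60δ ht' hec hle hsmall x hmargin hcentre φ h255

end Scale

end Literature.MathematicalPhysics.QuantumFieldTheory.Balaban1983to89.B2Eq265TailsScale

end
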